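import Summits.AtomisticToContinuum.Crystallization.Theorems.FrustratedLawDichotomyStrainedPatchWindowTaylorSplit
import Summits.AtomisticToContinuum.Crystallization.Theorems.FrustratedLawDichotomyStrainedPatchTaylorClose
import Summits.AtomisticToContinuum.Crystallization.Theorems.FrustratedLawDichotomyStrainedPatchRecutRecord

/-!
# (T2ʷ) PROVED — the tail half of the (T2-bent₁) proof re-run over `𝓘₁ʷ` (lens-5 g54, file TW; T-side of crux 27623)

Continuation of `…WindowTaylorSplit` (see its header for the mechanism and why the re-run is verbatim).  This file re-runs the frame-pinned
declarations of `…TaylorKband` (§3), `…TaylorTail`, `…TaylorCap` and `…TaylorClose` with `Frame ↦ FrameW`, `CompFamily1 ↦ CompFamilyW`,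
`TaylorTwoBent1 ↦ TaylorTwoBentW` (copied names suffixed `W`; MECHANICALLY GENERATED), USING every family-free declaration of the originals
(`members`, `outer`, `rimMembers`, `instRim`, `card_outer_le`, `image_mem_instRim`, `kbandCert_holds`, `pairChord_holds`, `fourteen_le_card_ball_hcp`,
the lattice counts of `…TaylorLattice`, …).  Terminal node: ★★★ `taylorTwoBentW_holds : TaylorTwoBentW` — (T2ʷ) holds outright; with
`…WindowFamilies.taylorTwoBent1_of_W` it also re-proves (T2-bent₁).  Consequence for the record (`…RecutRecord` §B): the binder `hT : TaylorTwoBentW` of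
`coreOff_record_g54W` is DISCHARGED (`coreOff_record_g54W_T2` below), so fix W′ of the RIM CRACK costs nothing on the `∀` side.
No sorry, no new axioms, no cite tokens.
-/

open scoped BigOperators Classical
open Summit.AtomisticToContinuum.Crystallization.Theorems.FrustratedLawDichotomyRangeCut (Sep)
open Summit.AtomisticToContinuum.Crystallization.Theorems.FrustratedLawDichotomyMotifLemmas
open Summit.AtomisticToContinuum.Crystallization.Theorems.FrustratedLawDichotomyAveragingCut
open Summit.AtomisticToContinuum.Crystallization.Theorems.FrustratedLawDichotomyAveragingRuleCap
open Summit.AtomisticToContinuum.Crystallization.Theorems.FrustratedLawDichotomyAveragingRuleTightFree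
open Summit.AtomisticToContinuum.Crystallization.Theorems.FrustratedLawDichotomyExemptAbsorptionRecord
open Summit.AtomisticToContinuum.Crystallization.Theorems.FrustratedLawDichotomySchurCut
open Literature.MathematicalPhysics.StatisticalMechanics (lennardJones lennardJones_nonpos)
open Summit.AtomisticToContinuum.Crystallization.Theorems.FrustratedLawDichotomyRuleToolkitGood
open Summit.AtomisticToContinuum.Crystallization.Theorems.FrustratedLawDichotomyStrainedPatchHomSplit
open Summit.AtomisticToContinuum.Crystallization.Theorems.FrustratedLawDichotomyStrainedPatchHomTermCalculus
open Summit.AtomisticToContinuum.Crystallization.Theorems.FrustratedLawDichotomyStrainedPatchChartFamilies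
open Summit.AtomisticToContinuum.Crystallization.Theorems.FrustratedLawDichotomyStrainedPatchChartFamiliesBent
open Summit.AtomisticToContinuum.Crystallization.Theorems.FrustratedLawDichotomyStrainedPatchChartFamiliesPinned
open Summit.AtomisticToContinuum.Crystallization.Theorems.FrustratedLawDichotomyStrainedPatchEnvelopeLaw
open Summit.AtomisticToContinuum.Crystallization.Theorems.FrustratedLawDichotomyStrainedPatchEnvelopeTaylor
open Summit.AtomisticToContinuum.Crystallization.Theorems.FrustratedLawDichotomyStrainedPatchTaylorSplit
open Summit.AtomisticToContinuum.Crystallization.Theorems.FrustratedLawDichotomyStrainedPatchTaylorPair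
open Summit.AtomisticToContinuum.Crystallization.Theorems.FrustratedLawDichotomyStrainedPatchTaylorChord
open Summit.AtomisticToContinuum.Crystallization.Theorems.FrustratedLawDichotomyStrainedPatchTaylorLeaves
open Summit.AtomisticToContinuum.Crystallization.Theorems.FrustratedLawDichotomyStrainedPatchTaylorRegular
open Summit.AtomisticToContinuum.Crystallization.Theorems.FrustratedLawDichotomyStrainedPatchTaylorKbandKit
open Summit.AtomisticToContinuum.Crystallization.Theorems.FrustratedLawDichotomyStrainedPatchTaylorKband
open Summit.AtomisticToContinuum.Crystallization.Theorems.FrustratedLawDichotomyStrainedPatchTaylorTail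
open Summit.AtomisticToContinuum.Crystallization.Theorems.FrustratedLawDichotomyStrainedPatchTaylorCap
open Literature.Barriers.AtomisticToContinuum.FlatleyTheil2015 (fccVec fccPoint norm_fccPoint_sq fccPoint_injective)
open Summit.AtomisticToContinuum.Crystallization.Theorems.FrustratedLawDichotomyStrainedPatchHomLattice (latPt_add latPt_sub latPt_neg)
open Summit.AtomisticToContinuum.Crystallization.Theorems.FrustratedLawDichotomyStrainedPatchHomRelief (latPt_fccVec_eq)
open Summit.AtomisticToContinuum.Crystallization.Theorems.FrustratedLawDichotomyStrainedPatchHomLatticeBox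
open Summit.AtomisticToContinuum.Crystallization.Theorems.FrustratedLawDichotomyStrainedPatchHomLatticeBoxHcp
open Summit.AtomisticToContinuum.Crystallization.Theorems.FrustratedLawDichotomyFarFieldSharp (card_le_of_separated_shell_three)
open Summit.AtomisticToContinuum.Crystallization.Theorems.FrustratedLawDichotomyStrainedPatchTaylorLattice
open Summit.AtomisticToContinuum.Crystallization.Theorems.FrustratedLawDichotomyStrainedPatchTaylorClose
open Summit.AtomisticToContinuum.Crystallization.Theorems.FrustratedLawDichotomyStrainedPatchRecutPairs
open Summit.AtomisticToContinuum.Crystallization.Theorems.FrustratedLawDichotomyStrainedPatchRecutKinematics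
open Summit.AtomisticToContinuum.Crystallization.Theorems.FrustratedLawDichotomyStrainedPatchWindowFamilies
open Summit.AtomisticToContinuum.Crystallization.Theorems.FrustratedLawDichotomyStrainedPatchWindowTaylorSplit
open Summit.AtomisticToContinuum.Crystallization.Theorems.FrustratedLawDichotomyStrainedPatchRecutRecord
open Summit.AtomisticToContinuum.Crystallization.Theorems.FrustratedLawDichotomyStrainedPatchCoreTube
open Summit.AtomisticToContinuum.Crystallization.Theorems.FrustratedLawDichotomyStrainedPatchStrainBands

namespace Summit.AtomisticToContinuum.Crystallization.Theorems.FrustratedLawDichotomyStrainedPatchWindowTaylorTail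

/-! ## W re-run of `…TaylorKband` -/

/-- (W re-run of `matchedTaylor_holds`.) ★★ (P2a) `MatchedTaylorW` PROVED. [folklore] -/
theorem matchedTaylor_holdsW : MatchedTaylorW := matchedTaylor_of_pairChordW pairChord_holds

/-- (W re-run of `taylorTwoBent1_of_tail`.) ★★★ THE (T2-bent₁) SEAM with every analytic piece discharged: `BeyondBallTailW → TaylorTwoBentW`. [folklore] -/
theorem taylorTwoBentW_of_tail (h3b : BeyondBallTailW) : TaylorTwoBentW := taylorTwoBentW_of_NT kbandCert_holds h3b

/-! ## W re-run of `…TaylorTail` -/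

/-- (W re-run of `RimCapCount`.) **(P3b-count) `RimCapCountW`** [GEOMETRIC COUNTING] — the weighted rim-cap count `Σ_{a member} (d_a − 9/5)²·#outer(a) / #B_{z₁}(e a) ≤ 2/3`
(`d_a = dist (z a) (z c)`; only members with `d_a > 9/5` have outer partners, and `(d_a − 9/5)² ≤ 1/400` for them). -/
def RimCapCountW : Prop :=
  FrameW fun _ z c _ z₁ c₁ e => ∑ a ∈ members z c z₁ c₁ e,
    (dist (z a) (z c) - 9 / 5) ^ 2 * ((outer z c a).card : ℝ) / ((ball (9 / 5) z₁ (e a)).card : ℝ) ≤ 2 / 3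

/-- (W re-run of `FlatCapCount`.) **(P3b-flat) `FlatCapCountW`** — the unweighted sufficient form `Σ_{a member} #outer(a) / #B_{z₁}(e a) ≤ 266`. -/
def FlatCapCountW : Prop :=
  FrameW fun _ z c _ z₁ c₁ e => ∑ a ∈ members z c z₁ c₁ e, ((outer z c a).card : ℝ) / ((ball (9 / 5) z₁ (e a)).card : ℝ) ≤ 266

/-- (W re-run of `beyondBallTail_of_rimCapCount`.) ★★ **(P3b) ⟸ (P3b-count)**: the rim-cap count gives `inBallFrozen ≤ frozenAvg + 10⁻⁵`. [folklore] -/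
theorem beyondBallTail_of_rimCapCountW (h : RimCapCountW) : BeyondBallTailW := by
  intro M z c M₁ z₁ c₁ e t hz hch hf
  have hX := h M z c M₁ z₁ c₁ e t hz hch hf
  have hdiff := frozenAvg_sub_inBallFrozen z c z₁ c₁ e
  have hsum : ∑ a ∈ members z c z₁ c₁ e,
      -(3 / 200000 * (dist (z a) (z c) - 9 / 5) ^ 2 * ((outer z c a).card : ℝ)) / ((ball (9 / 5) z₁ (e a)).card : ℝ) ≤
      ∑ a ∈ members z c z₁ c₁ e, (xSm M z a - matchSm (ball (63 / 10) z c) z a) / ((ball (9 / 5) z₁ (e a)).card : ℝ) :=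
    Finset.sum_le_sum fun a ha => div_le_div_of_nonneg_right (dropped_member_lb hf ha) (Nat.cast_nonneg _)
  have hscale : ∑ a ∈ members z c z₁ c₁ e,
      -(3 / 200000 * (dist (z a) (z c) - 9 / 5) ^ 2 * ((outer z c a).card : ℝ)) / ((ball (9 / 5) z₁ (e a)).card : ℝ) =
      -(3 / 200000) * ∑ a ∈ members z c z₁ c₁ e,
        (dist (z a) (z c) - 9 / 5) ^ 2 * ((outer z c a).card : ℝ) / ((ball (9 / 5) z₁ (e a)).card : ℝ) := by
    rw [Finset.mul_sum]
    refine Finset.sum_congr rfl fun a _ => ?_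
    ring
  rw [hscale] at hsum
  linarith

/-- (W re-run of `rimCapCount_of_flat`.) (P3b-flat) ⟹ (P3b-count): weights are at most `1/400` where the outer set is occupied (`266/400 ≤ 2/3`). [folklore] -/
theorem rimCapCount_of_flatW (h : FlatCapCountW) : RimCapCountW := by
  intro M z c M₁ z₁ c₁ e t hz hch hf
  have hX := h M z c M₁ z₁ c₁ e t hz hch hf
  have hle : ∑ a ∈ members z c z₁ c₁ e, (dist (z a) (z c) - 9 / 5) ^ 2 * ((outer z c a).card : ℝ) / ((ball (9 / 5) z₁ (e a)).card : ℝ) ≤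
      ∑ a ∈ members z c z₁ c₁ e, 1 / 400 * (((outer z c a).card : ℝ) / ((ball (9 / 5) z₁ (e a)).card : ℝ)) := by
    refine Finset.sum_le_sum fun a ha => ?_
    rw [mul_div_assoc]
    by_cases hne : (outer z c a).Nonempty
    · exact mul_le_mul_of_nonneg_right (weight_le_of_outer_nonempty hf ha hne) (by positivity)
    · rw [Finset.not_nonempty_iff_eq_empty.1 hne, Finset.card_empty, Nat.cast_zero, zero_div, mul_zero, mul_zero]
  rw [← Finset.mul_sum] at hle
  linarith

/-- (W re-run of `RimMass`.) **(P3b-mass) `RimMassW`** [INSTANCE GEOMETRY · census] — the rim members' inverse instance-memberships sum to at most `26/9`: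
`Σ_{a ∈ rim} 1/#B_{z₁}(e a) ≤ 26/9` (e.g. `≤ 37` rim members with `#B ≥ 13`). With the crude cap lemma (`≤ 92`) and weights `≤ 1/400` it gives (P3b-count). -/
def RimMassW : Prop :=
  FrameW fun _ z c _ z₁ c₁ e => ∑ a ∈ rimMembers z c z₁ c₁ e, (((ball (9 / 5) z₁ (e a)).card : ℝ))⁻¹ ≤ 26 / 9

/-- (W re-run of `rimCapCount_of_rimMass`.) ★★ **(P3b-mass) ⟹ (P3b-count)** (cap lemma + weights). [folklore] -/
theorem rimCapCount_of_rimMassW (h : RimMassW) : RimCapCountW := by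
  intro M z c M₁ z₁ c₁ e t hz hch hf
  have hX := h M z c M₁ z₁ c₁ e t hz hch hf
  have hle : ∀ a ∈ members z c z₁ c₁ e,
      (dist (z a) (z c) - 9 / 5) ^ 2 * ((outer z c a).card : ℝ) / ((ball (9 / 5) z₁ (e a)).card : ℝ) ≤
        if a ∈ rimMembers z c z₁ c₁ e then 23 / 100 * (((ball (9 / 5) z₁ (e a)).card : ℝ))⁻¹ else 0 := by
    intro a ha
    by_cases hne : (outer z c a).Nonempty
    · rw [if_pos (rim_of_outer_nonempty ha hne), div_eq_mul_inv]
      refine mul_le_mul_of_nonneg_right ?_ (by positivity)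
      have h1 := weight_le_of_outer_nonempty hf ha hne
      have h2 := card_outer_le hz hf ha
      nlinarith [sq_nonneg (dist (z a) (z c) - 9 / 5), Nat.cast_nonneg (α := ℝ) (outer z c a).card]
    · rw [Finset.not_nonempty_iff_eq_empty.1 hne, Finset.card_empty, Nat.cast_zero, mul_zero, zero_div]
      split_ifs <;> positivity
  refine (Finset.sum_le_sum hle).trans ?_
  rw [← Finset.sum_filter, show (members z c z₁ c₁ e).filter (fun a => a ∈ rimMembers z c z₁ c₁ e) = rimMembers z c z₁ c₁ e by
    ext a; simp only [rimMembers, Finset.mem_filter]; tauto, ← Finset.mul_sum]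
  linarith

/-- (W re-run of `InstanceRimMass`.) **(P3b-inst) `InstanceRimMassW`** [INSTANCE GEOMETRY ONLY · census over `𝓘₁⁺`] — for every comparison instance, the rim sites' inverse memberships
sum to at most `26/9`: `Σ_{b : 7/4 < |z₁ b − z₁ c₁| ≤ 9/5} 1/#B_{z₁}(b) ≤ 26/9` (no cluster in the statement). -/
def InstanceRimMassW : Prop :=
  ∀ (M₁ : ℕ) (z₁ : Fin M₁ → E3) (c₁ : Fin M₁), CompFamilyW M₁ z₁ c₁ →
    ∑ b ∈ instRim z₁ c₁, (((ball (9 / 5) z₁ b).card : ℝ))⁻¹ ≤ 26 / 9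

/-- (W re-run of `rimMass_of_instance`.) ★ **(P3b-inst) ⟹ (P3b-mass)**: `e` is injective on members and maps rim members into the instance rim. [folklore] -/
theorem rimMass_of_instanceW (h : InstanceRimMassW) : RimMassW := by
  intro M z c M₁ z₁ c₁ e t hz hch hf
  have hI := h M₁ z₁ c₁ hch.1
  have hinj : Set.InjOn e ↑(rimMembers z c z₁ c₁ e) := by
    intro a ha b hb hab
    have ha' := (Finset.mem_filter.1 (Finset.mem_filter.1 (Finset.mem_coe.1 ha)).1).1
    have hb' := (Finset.mem_filter.1 (Finset.mem_filter.1 (Finset.mem_coe.1 hb)).1).1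
    exact hch.2.2.2.2.1 a b (mem_ball.1 ha') (mem_ball.1 hb') hab
  have hsub : (rimMembers z c z₁ c₁ e).image e ⊆ instRim z₁ c₁ := by
    intro b hb
    obtain ⟨a, ha, rfl⟩ := Finset.mem_image.1 hb
    exact image_mem_instRim hf ha
  calc ∑ a ∈ rimMembers z c z₁ c₁ e, (((ball (9 / 5) z₁ (e a)).card : ℝ))⁻¹
      = ∑ b ∈ (rimMembers z c z₁ c₁ e).image e, (((ball (9 / 5) z₁ b).card : ℝ))⁻¹ :=
        (Finset.sum_image (f := fun b => (((ball (9 / 5) z₁ b).card : ℝ))⁻¹) hinj).symm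
    _ ≤ ∑ b ∈ instRim z₁ c₁, (((ball (9 / 5) z₁ b).card : ℝ))⁻¹ :=
        Finset.sum_le_sum_of_subset_of_nonneg hsub fun _ _ _ => by positivity
    _ ≤ 26 / 9 := hI

/-- (W re-run of `beyondBallTail_of_instanceRimMass`.) ★★ **(P3b) ⟸ (P3b-inst)**: the instance rim-mass bound gives the tail. [folklore] -/
theorem beyondBallTail_of_instanceRimMassW (h : InstanceRimMassW) : BeyondBallTailW :=
  beyondBallTail_of_rimCapCountW (rimCapCount_of_rimMassW (rimMass_of_instanceW h))

/-- (W re-run of `taylorTwoBent1_of_rimCapCount`.) (T2-bent₁) from the weighted rim-cap count. [folklore] -/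
theorem taylorTwoBentW_of_rimCapCount (h : RimCapCountW) : TaylorTwoBentW := taylorTwoBentW_of_tail (beyondBallTail_of_rimCapCountW h)

/-- (W re-run of `taylorTwoBent1_of_instanceRimMass`.)
★★★ (T2-bent₁) from the INSTANCE-ONLY rim mass: `InstanceRimMassW → TaylorTwoBentW` — every cluster-side piece of the node is proved. [folklore] -/
theorem taylorTwoBentW_of_instanceRimMass (h : InstanceRimMassW) : TaylorTwoBentW := taylorTwoBentW_of_tail (beyondBallTail_of_instanceRimMassW h)

/-! ## W re-run of `…TaylorCap` -/

/-- (W re-run of `RimMassLe`.) **(P3b-mass′) `RimMassLeW B`** — the rim members' inverse instance-memberships sum to at most `B`: `Σ_{a ∈ rim} 1/#B_{z₁}(e a) ≤ B`. -/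
def RimMassLeW (B : ℝ) : Prop :=
  FrameW fun _ z c _ z₁ c₁ e => ∑ a ∈ rimMembers z c z₁ c₁ e, (((ball (9 / 5) z₁ (e a)).card : ℝ))⁻¹ ≤ B

/-- (W re-run of `InstanceRimMassLe`.) **(P3b-inst′) `InstanceRimMassLeW B`** [INSTANCE GEOMETRY ONLY] — for every comparison instance `(z₁, c₁) ∈ 𝓘₁⁺`:
`Σ_{b : 7/4 < |z₁ b − z₁ c₁| ≤ 9/5} 1/#B_{z₁}(b) ≤ B` (no cluster in the statement). -/
def InstanceRimMassLeW (B : ℝ) : Prop :=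
  ∀ (M₁ : ℕ) (z₁ : Fin M₁ → E3) (c₁ : Fin M₁), CompFamilyW M₁ z₁ c₁ →
    ∑ b ∈ instRim z₁ c₁, (((ball (9 / 5) z₁ b).card : ℝ))⁻¹ ≤ B

/-- (W re-run of `rimCapCount_of_rimMassLe`.) ★★ **(P3b-mass′) ⟹ (P3b-count)** with the SHARP cap lemma: any rim-mass bound `B` with `21/400·B ≤ 2/3` suffices. [folklore] -/
theorem rimCapCount_of_rimMassLeW {B : ℝ} (hB : 21 / 400 * B ≤ 2 / 3) (h : RimMassLeW B) : RimCapCountW := by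
  intro M z c M₁ z₁ c₁ e t hz hch hf
  have hX := h M z c M₁ z₁ c₁ e t hz hch hf
  have hle : ∀ a ∈ members z c z₁ c₁ e,
      (dist (z a) (z c) - 9 / 5) ^ 2 * ((outer z c a).card : ℝ) / ((ball (9 / 5) z₁ (e a)).card : ℝ) ≤
        if a ∈ rimMembers z c z₁ c₁ e then 21 / 400 * (((ball (9 / 5) z₁ (e a)).card : ℝ))⁻¹ else 0 := by
    intro a ha
    by_cases hne : (outer z c a).Nonempty
    · rw [if_pos (rim_of_outer_nonempty ha hne), div_eq_mul_inv]
      refine mul_le_mul_of_nonneg_right ?_ (by positivity)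
      have h1 := weight_le_of_outer_nonempty hf ha hne
      have h2 := card_outer_le_sharp hz.2.1 (dist_le_of_member hf ha)
      nlinarith [sq_nonneg (dist (z a) (z c) - 9 / 5), Nat.cast_nonneg (α := ℝ) (outer z c a).card]
    · rw [Finset.not_nonempty_iff_eq_empty.1 hne, Finset.card_empty, Nat.cast_zero, mul_zero, zero_div]
      split_ifs <;> positivity
  refine (Finset.sum_le_sum hle).trans ?_
  rw [← Finset.sum_filter, show (members z c z₁ c₁ e).filter (fun a => a ∈ rimMembers z c z₁ c₁ e) = rimMembers z c z₁ c₁ e by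
    ext a; simp only [rimMembers, Finset.mem_filter]; tauto, ← Finset.mul_sum]
  have hsum0 : 0 ≤ ∑ a ∈ rimMembers z c z₁ c₁ e, (((ball (9 / 5) z₁ (e a)).card : ℝ))⁻¹ := Finset.sum_nonneg fun _ _ => by positivity
  nlinarith

/-- (W re-run of `rimMassLe_of_instance`.) ★ **(P3b-inst′) ⟹ (P3b-mass′)** (`e` injective on members, rim members map into the instance rim). [folklore] -/
theorem rimMassLe_of_instanceW {B : ℝ} (h : InstanceRimMassLeW B) : RimMassLeW B := by
  intro M z c M₁ z₁ c₁ e t hz hch hf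
  have hI := h M₁ z₁ c₁ hch.1
  have hinj : Set.InjOn e ↑(rimMembers z c z₁ c₁ e) := by
    intro a ha b hb hab
    have ha' := (Finset.mem_filter.1 (Finset.mem_filter.1 (Finset.mem_coe.1 ha)).1).1
    have hb' := (Finset.mem_filter.1 (Finset.mem_filter.1 (Finset.mem_coe.1 hb)).1).1
    exact hch.2.2.2.2.1 a b (mem_ball.1 ha') (mem_ball.1 hb') hab
  have hsub : (rimMembers z c z₁ c₁ e).image e ⊆ instRim z₁ c₁ := by
    intro b hb
    obtain ⟨a, ha, rfl⟩ := Finset.mem_image.1 hb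
    exact image_mem_instRim hf ha
  calc ∑ a ∈ rimMembers z c z₁ c₁ e, (((ball (9 / 5) z₁ (e a)).card : ℝ))⁻¹
      = ∑ b ∈ (rimMembers z c z₁ c₁ e).image e, (((ball (9 / 5) z₁ b).card : ℝ))⁻¹ :=
        (Finset.sum_image (f := fun b => (((ball (9 / 5) z₁ b).card : ℝ))⁻¹) hinj).symm
    _ ≤ ∑ b ∈ instRim z₁ c₁, (((ball (9 / 5) z₁ b).card : ℝ))⁻¹ :=
        Finset.sum_le_sum_of_subset_of_nonneg hsub fun _ _ _ => by positivity
    _ ≤ B := hI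

/-- (W re-run of `instanceRimMassLe_of_instanceRimMass`.) The crude residual of `…TaylorTail` is the case `B = 26/9`. [formal bookkeeping] -/
theorem instanceRimMassLe_of_instanceRimMassW (h : InstanceRimMassW) : InstanceRimMassLeW (26 / 9) := h

/-- (W re-run of `beyondBallTail_of_instanceRimMass12`.) ★★ **(P3b) ⟸ (P3b-inst′)** with `B = 38/3` (`21/400 · 38/3 = 0.665 ≤ 2/3`). [folklore] -/
theorem beyondBallTail_of_instanceRimMass12W (h : InstanceRimMassLeW (38 / 3)) : BeyondBallTailW :=
  beyondBallTail_of_rimCapCountW (rimCapCount_of_rimMassLeW (by norm_num) (rimMassLe_of_instanceW h))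

/-- (W re-run of `taylorTwoBent1_of_instanceRimMass12`.) ★★★ (T2-bent₁) from the instance-only rim mass `≤ 38/3`: `InstanceRimMassLeW (38/3) → TaylorTwoBentW`. [folklore] -/
theorem taylorTwoBentW_of_instanceRimMass12 (h : InstanceRimMassLeW (38 / 3)) : TaylorTwoBentW :=
  taylorTwoBentW_of_tail (beyondBallTail_of_instanceRimMass12W h)

/-! ## W re-run of `…TaylorClose` -/

/-- (W re-run of `fourteen_le_card_ball`.) ★★ Every rim site of a `𝓘₁⁺` instance has at least `14` instance sites within `9/5`. [folklore] -/
theorem fourteen_le_card_ballW {M₁ : ℕ} {z₁ : Fin M₁ → E3} {c₁ : Fin M₁} (hI : CompFamilyW M₁ z₁ c₁) {b : Fin M₁} (hb : b ∈ instRim z₁ c₁) :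
    14 ≤ (ball (9 / 5) z₁ b).card := by
  have hbent : IsBentBall bends1 (133 / 10) z₁ c₁ := hI.2.2.2.1
  obtain ⟨bm, z₀, hbm, ⟨G, ξ, hG, hξ, hrange⟩, hz⟩ := hbent
  obtain ⟨hbB, hb1⟩ := Finset.mem_filter.1 hb
  have hb2 : dist (z₁ b) (z₁ c₁) ≤ 9 / 5 := mem_ball.1 hbB
  rcases hrange with h | h
  · exact fourteen_le_card_ball_fcc hbm hz hG h hb1 hb2
  · exact fourteen_le_card_ball_hcp hbm hz hG hξ h hb1 hb2

/-- (W re-run of `card_instRim_le`.) ★ The rim of a `𝓘₁⁺` instance has at most `167` sites (`7/10`-separated points in the shell `7/4 ≤ r ≤ 9/5`: `(43/7)³ − 4³ < 168`). [folklore] -/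
theorem card_instRim_leW {M₁ : ℕ} {z₁ : Fin M₁ → E3} {c₁ : Fin M₁} (hI : CompFamilyW M₁ z₁ c₁) : ((instRim z₁ c₁).card : ℝ) ≤ 167 := by
  have hinj : Function.Injective z₁ := hI.1
  have hsep : Sep z₁ := hI.2.1
  rw [← Finset.card_image_of_injective (instRim z₁ c₁) hinj]
  have h := card_le_of_separated_shell_three ((instRim z₁ c₁).image z₁) (z₁ c₁) (δ := 7 / 10) (R := 7 / 4) (D := 9 / 5)
    (by norm_num) (by norm_num) (by norm_num) ?_ ?_
  · have h' : ((((instRim z₁ c₁).image z₁).card : ℕ) : ℝ) < 168 := h.trans_lt (by norm_num)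
    have h'' : ((instRim z₁ c₁).image z₁).card < 168 := by exact_mod_cast h'
    exact_mod_cast Nat.lt_succ_iff.1 h''
  · intro x hx y hy hxy
    obtain ⟨i, -, rfl⟩ := Finset.mem_image.1 hx
    obtain ⟨j, -, rfl⟩ := Finset.mem_image.1 hy
    exact hsep i j (fun hij => hxy (by rw [hij]))
  · intro x hx
    obtain ⟨i, hi, rfl⟩ := Finset.mem_image.1 hx
    obtain ⟨hiB, hi1⟩ := Finset.mem_filter.1 hi
    exact ⟨hi1.le, mem_ball.1 hiB⟩

/-- (W re-run of `instanceRimMass_le`.) ★★★ THE INSTANCE RIM MASS BOUND: `Σ_{b ∈ instRim} 1/#B(b) ≤ 167/14 ≤ 38/3` on every `𝓘₁⁺` instance. [folklore] -/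
theorem instanceRimMass_leW {M₁ : ℕ} {z₁ : Fin M₁ → E3} {c₁ : Fin M₁} (hI : CompFamilyW M₁ z₁ c₁) :
    ∑ b ∈ instRim z₁ c₁, (((ball (9 / 5) z₁ b).card : ℝ))⁻¹ ≤ 38 / 3 := by
  calc ∑ b ∈ instRim z₁ c₁, (((ball (9 / 5) z₁ b).card : ℝ))⁻¹ ≤ ∑ b ∈ instRim z₁ c₁, (14 : ℝ)⁻¹ :=
        Finset.sum_le_sum fun b hb => inv_anti₀ (by norm_num) (by exact_mod_cast fourteen_le_card_ballW hI hb)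
    _ = (instRim z₁ c₁).card * (14 : ℝ)⁻¹ := by rw [Finset.sum_const, nsmul_eq_mul]
    _ ≤ 167 * (14 : ℝ)⁻¹ := by gcongr; exact card_instRim_leW hI
    _ ≤ 38 / 3 := by norm_num

/-- (W re-run of `instanceRimMassLe_holds`.) ★★★ **(P3b-inst′) PROVED**: `InstanceRimMassLeW (38/3)`. [folklore] -/
theorem instanceRimMassLe_holdsW : InstanceRimMassLeW (38 / 3) := fun _ _ _ hI => instanceRimMass_leW hI

/-- (W re-run of `taylorTwoBent1_holds`.) ★★★ **(T2-bent₁) PROVED**: `TaylorTwoBentW = SmoothTaylorTwo CompFamilyW tau1 delta0 G0 w0 rho0` holds outright. [folklore] -/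
theorem taylorTwoBentW_holds : TaylorTwoBentW := taylorTwoBentW_of_instanceRimMass12 instanceRimMassLe_holdsW

/-! ## Consequences for the g54 record (file P `…RecutRecord` §B) -/

-- (T2-bent₁) is also re-provable through (T2ʷ) as `taylorTwoBent1_of_W taylorTwoBentW_holds`; the statement coincides with the landed
-- `…TaylorClose.taylorTwoBent1_holds` (gate dedup), so no separate declaration is kept here.

/-- ★★★ **THE g54 RECORD OVER THE WINDOW-HONEST FAMILIES WITH (T2ʷ) DISCHARGED** — nine binders:
(BASᴿ-bentW) (MEMᴿ-bentW μ) (LINᴿ-bentW Ψ) (RFᴿ-bentW) (DOMᴿ-bentW (Ψ ⊕ μ)) (F2ᴿ-bentW0) (F3ᴿ-bentW) [BRIDGE] [SOFT-FAR] ⟹ [CORE-FAR]. [folklore] -/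
theorem coreOff_record_g54W_T2 {Ψ : (M₁ : ℕ) → (Fin M₁ → E3) → Fin M₁ → ℝ → ℝ} {μ : (M₁ : ℕ) → (Fin M₁ → E3) → Fin M₁ → ℝ}
    (hB : BasinRBentW) (hM : MembershipRBentW μ) (hL : SlavedRBentW Ψ) (hRF : RecutBentW) (hD : DominationRBentW (withColumns Ψ μ))
    (hR : FamilyRoomRBentW0) (hC : FamilyCertRBentW) (hBand : BandFarFloor (63 / 10) (63 / 10) (24 / 5) (1 / 100) (3 / 50) (1 / 10) 0)
    (hS : SoftFarFloor (63 / 10) (63 / 10) (24 / 5) (1 / 100) (1 / 10) 0) : CoreOffTubeFloor (63 / 10) (63 / 10) (24 / 5) (1 / 100) 0 :=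
  coreOff_record_g54W hB taylorTwoBentW_holds hM hL hRF hD hR hC hBand hS

/-- The corresponding edge form. [formal bookkeeping] -/
theorem edgeFar_record_g54W_T2 {Ψ : (M₁ : ℕ) → (Fin M₁ → E3) → Fin M₁ → ℝ → ℝ} {μ : (M₁ : ℕ) → (Fin M₁ → E3) → Fin M₁ → ℝ}
    (hB : BasinRBentW) (hM : MembershipRBentW μ) (hL : SlavedRBentW Ψ) (hRF : RecutBentW) (hD : DominationRBentW (withColumns Ψ μ))
    (hR : FamilyRoomRBentW0) (hC : FamilyCertRBentW) : EdgeFarFloor (63 / 10) (63 / 10) (24 / 5) (1 / 100) (3 / 50) 0 :=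
  edgeFar_record_g54W hB taylorTwoBentW_holds hM hL hRF hD hR hC

/-- ★★★ The §A record (g53 families) with (T2-bent₁) discharged — nine binders. [folklore] -/
theorem coreOff_record_g54_T2 {Ψ : (M₁ : ℕ) → (Fin M₁ → E3) → Fin M₁ → ℝ → ℝ} {μ : (M₁ : ℕ) → (Fin M₁ → E3) → Fin M₁ → ℝ}
    (hB : BasinRBent1) (hM : MembershipRBent1 μ) (hL : SlavedRBent1 Ψ) (hRF : RecutBent1) (hD : DominationRBent1 (withColumns Ψ μ))
    (hR : FamilyRoomRBent0) (hC : FamilyCertRBent1) (hBand : BandFarFloor (63 / 10) (63 / 10) (24 / 5) (1 / 100) (3 / 50) (1 / 10) 0)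
    (hS : SoftFarFloor (63 / 10) (63 / 10) (24 / 5) (1 / 100) (1 / 10) 0) : CoreOffTubeFloor (63 / 10) (63 / 10) (24 / 5) (1 / 100) 0 :=
  coreOff_record_g54 hB taylorTwoBent1_holds hM hL hRF hD hR hC hBand hS

end Summit.AtomisticToContinuum.Crystallization.Theorems.FrustratedLawDichotomyStrainedPatchWindowTaylorTail
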